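import Mathlib
import HarnessLib
import Summits.HubbardSuperconductivity.HubbardSuperconductivity.Theorems.KLProgrammeKLRegimeTorusAdditiveSexticWeightMoment

/-!
# Route `KLProgramme` — engine support (route (L2), ADDITIVE weight, FIRST MOMENT, MIXED ORDERS along the tangent): the rotated-box count with
# two radii and the MIXED-BASE LAYER CAKE behind the summability of `(1 + X + I₁ + I₂)²/(1 + X⁶ + I₁⁶ + I₂⁶ + Y⁶ + Z⁴ + Z'⁶)` on `(ℤ/Pℤ)¹ × (ℤ/Lℤ)²`

Cell `gate-hubbard-kl`, seat p3 (g10), for the ENGINE child stmt-HubbardSuperconductivity-20437 (`stub_engine_step_norms`: the WEIGHTED lines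
`KernelNormsWt4 … K_n j`, `j ≥ 1`, and conjunct 3 (E4)ₙ through W1 = the weighted torus bound of the level-`n` anisotropic sector functions;
located risk «(b)-Wt@j≥1»).  The order-three file `…TorusAdditiveSexticWeightMoment` (p3 g9) asks for THIRD differences along the sector
tangent `v` at the anisotropic rate `s₃ ≍ Λ_n` — finding W1-TAN3 (KL STATUS 2026-08-27 15:19Z): on the flow frame that datum is not n-free
(the isotropic (I-F jets) give `‖D³K_n‖ ≲ U²4ⁿ`, an overshoot `U²2ⁿ` along the tangent).  What IS available n-free along `v`: SECOND differences at
the anisotropic rate `s₃` (`C²` band data) and THIRD differences at the isotropic rate `s₃' ≍ s₂` (`C³` data).  This file is the `Σ w²W⁻¹`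
factor of the corresponding `ℓ²` route: decay variables `X = s₀|j̃|`, `I₁ = s₁|z̃₁|`, `I₂ = s₁|z̃₂|`, `Y = s₂|ã_{v⊥}(z)|`, `Z = s₃|ã_v(z)|`,
`Z' = s₃'|ã_v(z)|`, weight `W = 1 + X⁶ + I₁⁶ + I₂⁶ + Y⁶ + Z⁴ + Z'⁶`, moment numerator `(1 + X + I₁ + I₂)²`:

* §1 `card_filter_frame_near_le'` — the rotated-box count with two radii: `#{s₂|v⊥·z̃| ≤ R, s₃|v·z̃| ≤ R'} ≤ (2√2/(s₂|v|)+2)(2√2/(s₃|v|)+2)·R·R'`;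
* §2 **`sum_sq_mul_inv_le_of_mixed_levels`** — the MIXED-BASE layer cake: on a finite set with `0 ≤ w ≤ C(1 + X + Y + Z')` and
  `#{X ≤ 4^k, Y ≤ 4^k, Z ≤ 8^k} ≤ A·128^k` for all `k`, `Σ w²·(1 + X⁶ + Y⁶ + Z⁴ + Z'⁶)⁻¹ ≤ 131072·A·C²` (levels `S_k = {X, Y, Z' ≤ 4^k, Z ≤ 8^k}`:
  leaving `S_{k−1}` forces `W ≥ 4096^{k−1}`, staying in `S_k` forces `w² ≤ 16C²·16^k`; `128^k·16^k/4096^k = 2^{-k}·…`);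
* the assembled moment sum `sum_sq_mul_inv_mixedWeight_le` is in the companion `…TorusMixedWeightMoment` (this file = its two counting lemmas).

Everything is proved; no definitions, no named facts. [folklore]

References: G. Benfatto, A. Giuliani, V. Mastropietro, Ann. Henri Poincaré 7 (2006) 809–898, Lemma 2.2 (2.52)–(2.55) (tangential derivatives
cost `γ^{-h/2}` up to order two and `γ^{-h}` beyond, (2.55)), §2.6 (2.81) and footnote ¹.
-/

noncomputable section

namespace Summit.HubbardSuperconductivity.HubbardSuperconductivity.Theorems.TorusFourierL2

set_option linter.dupNamespace false -- summit = problem name (single-conjunct summit), D-0017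

open Finset Literature.Probability.LatticeModels
open scoped Real

/-! ### §1 The rotated-box count with two radii -/

/-- **The near frame box with two radii**: for an integer vector `v ≠ 0` (`|v| = √(v₁²+v₂²)`), rates `s₂, s₃ > 0` and `R, R' ≥ 1`,
`#{z : s₂|v⊥·z̃| ≤ R, s₃|v·z̃| ≤ R'} ≤ (2√2/(s₂|v|) + 2)(2√2/(s₃|v|) + 2)·R·R'` (the proof of `card_filter_frame_near_le` with independent radii).
[folklore] -/
theorem card_filter_frame_near_le' {L : ℕ} [NeZero L] (v : Fin 2 → ℤ) (hv : v ≠ 0)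
    {s₂ s₃ : ℝ} (hs₂ : 0 < s₂) (hs₃ : 0 < s₃) {R R' : ℝ} (hR : 1 ≤ R) (hR' : 1 ≤ R') :
    (((univ.filter fun z : TorusSite 2 L =>
        s₂ * |(-(v 1 : ℝ)) * (((z 0).valMinAbs : ℤ) : ℝ) + (v 0 : ℝ) * (((z 1).valMinAbs : ℤ) : ℝ)| ≤ R ∧
        s₃ * |(v 0 : ℝ) * (((z 0).valMinAbs : ℤ) : ℝ) + (v 1 : ℝ) * (((z 1).valMinAbs : ℤ) : ℝ)| ≤ R').card : ℕ) : ℝ) ≤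
      ((2 * Real.sqrt 2 / (s₂ * Real.sqrt ((v 0 : ℝ) ^ 2 + (v 1 : ℝ) ^ 2)) + 2) *
        (2 * Real.sqrt 2 / (s₃ * Real.sqrt ((v 0 : ℝ) ^ 2 + (v 1 : ℝ) ^ 2)) + 2)) * (R * R') := by
  classical
  have hv2 : (0 : ℝ) < (v 0 : ℝ) ^ 2 + (v 1 : ℝ) ^ 2 := by
    by_contra h
    have h0 : (v 0 : ℝ) = 0 := by nlinarith [sq_nonneg (v 0 : ℝ), sq_nonneg (v 1 : ℝ)]
    have h1 : (v 1 : ℝ) = 0 := by nlinarith [sq_nonneg (v 0 : ℝ), sq_nonneg (v 1 : ℝ)]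
    have h0' : v 0 = 0 := by exact_mod_cast h0
    have h1' : v 1 = 0 := by exact_mod_cast h1
    exact hv (funext fun i => by fin_cases i <;> assumption)
  set r : ℝ := Real.sqrt ((v 0 : ℝ) ^ 2 + (v 1 : ℝ) ^ 2) with hr
  have hrpos : 0 < r := Real.sqrt_pos.2 hv2
  have hrsq : r ^ 2 = (v 0 : ℝ) ^ 2 + (v 1 : ℝ) ^ 2 := Real.sq_sqrt hv2.le
  set n : Fin 2 → ℝ := ![-(v 1 : ℝ) / r, (v 0 : ℝ) / r] with hn
  set τ : Fin 2 → ℝ := ![(v 0 : ℝ) / r, (v 1 : ℝ) / r] with hτ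
  have hn0 : n 0 = -(v 1 : ℝ) / r := rfl
  have hn1' : n 1 = (v 0 : ℝ) / r := rfl
  have hτ0 : τ 0 = (v 0 : ℝ) / r := rfl
  have hτ1' : τ 1 = (v 1 : ℝ) / r := rfl
  have hn1 : n 0 ^ 2 + n 1 ^ 2 = 1 := by rw [hn0, hn1']; field_simp; linarith [hrsq]
  have hτ1 : τ 0 ^ 2 + τ 1 ^ 2 = 1 := by rw [hτ0, hτ1']; field_simp; linarith [hrsq]
  have hnτ : n 0 * τ 0 + n 1 * τ 1 = 0 := by rw [hn0, hn1', hτ0, hτ1']; field_simp; ring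
  set X : TorusSite 2 L → ℝ := fun z => (((z 0).valMinAbs : ℤ) : ℝ) * n 0 + (((z 1).valMinAbs : ℤ) : ℝ) * n 1 with hX
  set Y : TorusSite 2 L → ℝ := fun z => (((z 0).valMinAbs : ℤ) : ℝ) * τ 0 + (((z 1).valMinAbs : ℤ) : ℝ) * τ 1 with hY
  have hs2 : (0 : ℝ) < Real.sqrt 2 := Real.sqrt_pos.2 two_pos
  have hs2sq : Real.sqrt 2 ^ 2 = 2 := Real.sq_sqrt two_pos.le
  have hδ : (0 : ℝ) < (Real.sqrt 2)⁻¹ := inv_pos.2 hs2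
  have hsep : ∀ a b : TorusSite 2 L, |X a - X b| < (Real.sqrt 2)⁻¹ → |Y a - Y b| < (Real.sqrt 2)⁻¹ → a = b := by
    intro a b hXab hYab
    set u : Fin 2 → ℝ := ![(((a 0).valMinAbs : ℤ) : ℝ) - (((b 0).valMinAbs : ℤ) : ℝ),
      (((a 1).valMinAbs : ℤ) : ℝ) - (((b 1).valMinAbs : ℤ) : ℝ)] with hu
    have hX' : |u 0 * n 0 + u 1 * n 1| < (Real.sqrt 2)⁻¹ := by
      convert hXab using 2; simp [hu, hX]; ring
    have hY' : |u 0 * τ 0 + u 1 * τ 1| < (Real.sqrt 2)⁻¹ := by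
      convert hYab using 2; simp [hu, hY]; ring
    have hA := sq_lt_sq' (abs_lt.1 hX').1 (abs_lt.1 hX').2
    have hB := sq_lt_sq' (abs_lt.1 hY').1 (abs_lt.1 hY').2
    have hsum : u 0 ^ 2 + u 1 ^ 2 < 1 := by
      have h2inv : ((Real.sqrt 2)⁻¹) ^ 2 = 2⁻¹ := by rw [inv_pow, hs2sq]
      rw [h2inv] at hA hB
      rw [← frame_sq_add_sq_eq hn1 hτ1 hnτ u]
      linarith
    have h0 : u 0 ^ 2 < 1 := by nlinarith [sq_nonneg (u 1)]
    have h1 : u 1 ^ 2 < 1 := by nlinarith [sq_nonneg (u 0)]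
    have e0 : |(((a 0).valMinAbs : ℤ) : ℝ) - (((b 0).valMinAbs : ℤ) : ℝ)| < 1 := by
      have := (sq_lt_one_iff_abs_lt_one (u 0)).1 h0; simpa [hu] using this
    have e1 : |(((a 1).valMinAbs : ℤ) : ℝ) - (((b 1).valMinAbs : ℤ) : ℝ)| < 1 := by
      have := (sq_lt_one_iff_abs_lt_one (u 1)).1 h1; simpa [hu] using this
    exact funext fun i => by
      fin_cases i
      · exact valMinAbs_eq_of_abs_sub_lt _ _ e0
      · exact valMinAbs_eq_of_abs_sub_lt _ _ e1
  have hR1 : 0 ≤ R / (s₂ * r) := by positivity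
  have hR2 : 0 ≤ R' / (s₃ * r) := by positivity
  have hcount := card_filter_abs_le_le_of_separated X Y hδ hsep hR1 hR2
  have k1 : ∀ z : TorusSite 2 L, r * X z =
      (-(v 1 : ℝ)) * (((z 0).valMinAbs : ℤ) : ℝ) + (v 0 : ℝ) * (((z 1).valMinAbs : ℤ) : ℝ) := fun z => by
    simp only [hX, hn0, hn1']; field_simp
  have k2 : ∀ z : TorusSite 2 L, r * Y z =
      (v 0 : ℝ) * (((z 0).valMinAbs : ℤ) : ℝ) + (v 1 : ℝ) * (((z 1).valMinAbs : ℤ) : ℝ) := fun z => by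
    simp only [hY, hτ0, hτ1']; field_simp
  have hsub : (univ.filter fun z : TorusSite 2 L =>
        s₂ * |(-(v 1 : ℝ)) * (((z 0).valMinAbs : ℤ) : ℝ) + (v 0 : ℝ) * (((z 1).valMinAbs : ℤ) : ℝ)| ≤ R ∧
        s₃ * |(v 0 : ℝ) * (((z 0).valMinAbs : ℤ) : ℝ) + (v 1 : ℝ) * (((z 1).valMinAbs : ℤ) : ℝ)| ≤ R') ⊆
      univ.filter fun z => |X z| ≤ R / (s₂ * r) ∧ |Y z| ≤ R' / (s₃ * r) := by
    intro z hz
    obtain ⟨h1, h2⟩ := (mem_filter.1 hz).2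
    rw [← k1 z, abs_mul, abs_of_pos hrpos] at h1
    rw [← k2 z, abs_mul, abs_of_pos hrpos] at h2
    refine mem_filter.2 ⟨mem_univ _, ?_, ?_⟩
    · rw [le_div_iff₀ (mul_pos hs₂ hrpos)]; linarith
    · rw [le_div_iff₀ (mul_pos hs₃ hrpos)]; linarith
  have hfac : ∀ {s T : ℝ}, 0 < s → 1 ≤ T → 2 * (T / (s * r)) / (Real.sqrt 2)⁻¹ + 2 ≤ (2 * Real.sqrt 2 / (s * r) + 2) * T := by
    intro s T hs hT
    rw [div_inv_eq_mul]
    have hsr : 0 < s * r := mul_pos hs hrpos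
    have : 2 * (T / (s * r)) * Real.sqrt 2 = 2 * Real.sqrt 2 / (s * r) * T := by field_simp
    rw [this, add_mul]
    linarith
  calc (((univ.filter fun z : TorusSite 2 L =>
        s₂ * |(-(v 1 : ℝ)) * (((z 0).valMinAbs : ℤ) : ℝ) + (v 0 : ℝ) * (((z 1).valMinAbs : ℤ) : ℝ)| ≤ R ∧
        s₃ * |(v 0 : ℝ) * (((z 0).valMinAbs : ℤ) : ℝ) + (v 1 : ℝ) * (((z 1).valMinAbs : ℤ) : ℝ)| ≤ R').card : ℕ) : ℝ)
      ≤ (((univ.filter fun z => |X z| ≤ R / (s₂ * r) ∧ |Y z| ≤ R' / (s₃ * r)).card : ℕ) : ℝ) := by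
        exact_mod_cast card_le_card hsub
    _ ≤ (2 * (R / (s₂ * r)) / (Real.sqrt 2)⁻¹ + 2) * (2 * (R' / (s₃ * r)) / (Real.sqrt 2)⁻¹ + 2) := hcount
    _ ≤ ((2 * Real.sqrt 2 / (s₂ * r) + 2) * R) * ((2 * Real.sqrt 2 / (s₃ * r) + 2) * R') :=
        mul_le_mul (hfac hs₂ hR) (hfac hs₃ hR') (by positivity) (by positivity)
    _ = _ := by ring

/-! ### §2 The mixed-base layer cake -/

/-- **The mixed-base layer cake.**  On a finite set `S` let `X, Y, Z, Z' ≥ 0` and `0 ≤ w ≤ C·(1 + X + Y + Z')`, and suppose the boxes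
`{X ≤ 4^k, Y ≤ 4^k, Z ≤ 8^k}` have at most `A·128^k` points for every `k`.  Then
`Σ_{S} w²·(1 + X⁶ + Y⁶ + Z⁴ + Z'⁶)⁻¹ ≤ 131072·A·C²`.
(Levels `S_k = {X, Y, Z' ≤ 4^k, Z ≤ 8^k}`: a point of level `k` has `1 + X⁶ + Y⁶ + Z⁴ + Z'⁶ ≥ 4096^k/4096` — one variable left `S_{k−1}`, and
`(4^{k−1})⁶ = (8^{k−1})⁴ = 4096^{k−1}` — and `w² ≤ 16C²·16^k`; the count of level `k` is `≤ A·128^k`; `Σ_k 128^k·16^k·4096/4096^k = 4096·Σ 2^{-k}`.)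
[folklore] -/
theorem sum_sq_mul_inv_le_of_mixed_levels {α : Type*} [DecidableEq α] (S : Finset α) (X Y Z Z' w : α → ℝ)
    (hX : ∀ z ∈ S, 0 ≤ X z) (hY : ∀ z ∈ S, 0 ≤ Y z) (hZ : ∀ z ∈ S, 0 ≤ Z z) (hZ' : ∀ z ∈ S, 0 ≤ Z' z)
    (hw : ∀ z ∈ S, 0 ≤ w z) {C : ℝ} (hwC : ∀ z ∈ S, w z ≤ C * (1 + X z + Y z + Z' z)) {A : ℝ} (hA : 0 ≤ A)
    (hcount : ∀ k : ℕ, (((S.filter fun z => X z ≤ (4 : ℝ) ^ k ∧ Y z ≤ (4 : ℝ) ^ k ∧ Z z ≤ (8 : ℝ) ^ k).card : ℕ) : ℝ) ≤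
      A * (128 : ℝ) ^ k) :
    ∑ z ∈ S, w z ^ 2 * (1 + X z ^ 6 + Y z ^ 6 + Z z ^ 4 + Z' z ^ 6)⁻¹ ≤ 131072 * A * C ^ 2 := by
  classical
  -- every point has a level
  have hlev_ex : ∀ z, ∃ k : ℕ, X z ≤ (4 : ℝ) ^ k ∧ Y z ≤ (4 : ℝ) ^ k ∧ Z' z ≤ (4 : ℝ) ^ k ∧ Z z ≤ (8 : ℝ) ^ k := by
    intro z
    obtain ⟨k, hk⟩ := pow_unbounded_of_one_lt (max (max (X z) (Y z)) (max (Z' z) (Z z))) (by norm_num : (1 : ℝ) < 4)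
    have h48 : (4 : ℝ) ^ k ≤ (8 : ℝ) ^ k := pow_le_pow_left₀ (by norm_num) (by norm_num) k
    refine ⟨k, ?_, ?_, ?_, ?_⟩
    · exact le_trans (le_trans (le_max_left _ _) (le_max_left _ _)) hk.le
    · exact le_trans (le_trans (le_max_right _ _) (le_max_left _ _)) hk.le
    · exact le_trans (le_trans (le_max_left _ _) (le_max_right _ _)) hk.le
    · exact le_trans (le_trans (le_trans (le_max_right _ _) (le_max_right _ _)) hk.le) h48
  let lev : α → ℕ := fun z => Nat.find (hlev_ex z)
  have hlev_spec : ∀ z, X z ≤ (4 : ℝ) ^ (lev z) ∧ Y z ≤ (4 : ℝ) ^ (lev z) ∧ Z' z ≤ (4 : ℝ) ^ (lev z) ∧ Z z ≤ (8 : ℝ) ^ (lev z) :=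
    fun z => Nat.find_spec (hlev_ex z)
  have hlev_min : ∀ z k, k < lev z → ¬ (X z ≤ (4 : ℝ) ^ k ∧ Y z ≤ (4 : ℝ) ^ k ∧ Z' z ≤ (4 : ℝ) ^ k ∧ Z z ≤ (8 : ℝ) ^ k) :=
    fun z k hk => Nat.find_min (hlev_ex z) hk
  -- the weight at level `k` is at least `4096^k / 4096`
  have hW : ∀ z ∈ S, (4096 : ℝ) ^ (lev z) / 4096 ≤ 1 + X z ^ 6 + Y z ^ 6 + Z z ^ 4 + Z' z ^ 6 := by
    intro z hz
    have hX6 := pow_nonneg (hX z hz) 6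
    have hY6 := pow_nonneg (hY z hz) 6
    have hZ4 := pow_nonneg (hZ z hz) 4
    have hZ'6 := pow_nonneg (hZ' z hz) 6
    rcases Nat.eq_zero_or_pos (lev z) with h0 | hpos
    · rw [h0, pow_zero]; norm_num; linarith
    · obtain ⟨k, hk⟩ : ∃ k, lev z = k + 1 := ⟨lev z - 1, by omega⟩
      have hnot := hlev_min z k (by omega)
      have e4096 : (4096 : ℝ) ^ (lev z) / 4096 = (4096 : ℝ) ^ k := by rw [hk, pow_succ]; field_simp
      rw [e4096]
      have e6 : ((4 : ℝ) ^ k) ^ 6 = (4096 : ℝ) ^ k := by rw [← pow_mul, mul_comm, pow_mul]; norm_num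
      have e4 : ((8 : ℝ) ^ k) ^ 4 = (4096 : ℝ) ^ k := by rw [← pow_mul, mul_comm, pow_mul]; norm_num
      simp only [not_and_or, not_le] at hnot
      rcases hnot with h | h | h | h
      · have : (4096 : ℝ) ^ k ≤ X z ^ 6 := by rw [← e6]; exact pow_le_pow_left₀ (by positivity) h.le 6
        linarith
      · have : (4096 : ℝ) ^ k ≤ Y z ^ 6 := by rw [← e6]; exact pow_le_pow_left₀ (by positivity) h.le 6
        linarith
      · have : (4096 : ℝ) ^ k ≤ Z' z ^ 6 := by rw [← e6]; exact pow_le_pow_left₀ (by positivity) h.le 6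
        linarith
      · have : (4096 : ℝ) ^ k ≤ Z z ^ 4 := by rw [← e4]; exact pow_le_pow_left₀ (by positivity) h.le 4
        linarith
  -- the numerator at level `k` is at most `16C²·16^k`
  have hC0 : ∀ z ∈ S, 0 ≤ C ∨ w z = 0 := by
    intro z hz
    by_cases hC : 0 ≤ C
    · exact Or.inl hC
    · right
      have h1 : w z ≤ C * (1 + X z + Y z + Z' z) := hwC z hz
      have hf : 1 ≤ 1 + X z + Y z + Z' z := by linarith [hX z hz, hY z hz, hZ' z hz]
      have : C * (1 + X z + Y z + Z' z) ≤ 0 := mul_nonpos_of_nonpos_of_nonneg (le_of_lt (not_le.1 hC)) (by linarith)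
      linarith [hw z hz]
  have hnum : ∀ z ∈ S, w z ^ 2 ≤ 16 * C ^ 2 * (16 : ℝ) ^ (lev z) := by
    intro z hz
    obtain ⟨h1, h2, h3, -⟩ := hlev_spec z
    have h4k : (1 : ℝ) ≤ (4 : ℝ) ^ (lev z) := one_le_pow₀ (by norm_num)
    have hf : 1 + X z + Y z + Z' z ≤ 4 * (4 : ℝ) ^ (lev z) := by linarith
    have e16 : ((4 : ℝ) ^ (lev z)) ^ 2 = (16 : ℝ) ^ (lev z) := by rw [← pow_mul, mul_comm, pow_mul]; norm_num
    rcases hC0 z hz with hC | hw0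
    · have hwle : w z ≤ C * (4 * (4 : ℝ) ^ (lev z)) := (hwC z hz).trans (mul_le_mul_of_nonneg_left hf hC)
      calc w z ^ 2 ≤ (C * (4 * (4 : ℝ) ^ (lev z))) ^ 2 := pow_le_pow_left₀ (hw z hz) hwle 2
        _ = 16 * C ^ 2 * (16 : ℝ) ^ (lev z) := by rw [← e16]; ring
    · rw [hw0, zero_pow two_ne_zero]; positivity
  -- pointwise cost
  have hcost : ∀ z ∈ S, w z ^ 2 * (1 + X z ^ 6 + Y z ^ 6 + Z z ^ 4 + Z' z ^ 6)⁻¹ ≤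
      65536 * C ^ 2 * (1 / 256 : ℝ) ^ (lev z) := by
    intro z hz
    have hWpos : 0 < (4096 : ℝ) ^ (lev z) / 4096 := by positivity
    have hinv : (1 + X z ^ 6 + Y z ^ 6 + Z z ^ 4 + Z' z ^ 6)⁻¹ ≤ ((4096 : ℝ) ^ (lev z) / 4096)⁻¹ := inv_anti₀ hWpos (hW z hz)
    have e : 16 * C ^ 2 * (16 : ℝ) ^ (lev z) * ((4096 : ℝ) ^ (lev z) / 4096)⁻¹ = 65536 * C ^ 2 * (1 / 256 : ℝ) ^ (lev z) := by
      have h4096 : (4096 : ℝ) ^ (lev z) = (16 : ℝ) ^ (lev z) * (256 : ℝ) ^ (lev z) := by rw [← mul_pow]; norm_num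
      rw [h4096, one_div, inv_pow]
      have h16 : (16 : ℝ) ^ (lev z) ≠ 0 := by positivity
      have h256 : (256 : ℝ) ^ (lev z) ≠ 0 := by positivity
      field_simp
      ring
    calc w z ^ 2 * (1 + X z ^ 6 + Y z ^ 6 + Z z ^ 4 + Z' z ^ 6)⁻¹
        ≤ (16 * C ^ 2 * (16 : ℝ) ^ (lev z)) * ((4096 : ℝ) ^ (lev z) / 4096)⁻¹ :=
          mul_le_mul (hnum z hz) hinv (inv_nonneg.2 (by positivity)) (by positivity)
      _ = 65536 * C ^ 2 * (1 / 256 : ℝ) ^ (lev z) := e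
  -- the count of each level
  have hfib : ∀ k : ℕ, (((S.filter fun z => lev z = k).card : ℕ) : ℝ) ≤ A * (128 : ℝ) ^ k := by
    intro k
    have hsub : (S.filter fun z => lev z = k) ⊆ S.filter fun z => X z ≤ (4 : ℝ) ^ k ∧ Y z ≤ (4 : ℝ) ^ k ∧ Z z ≤ (8 : ℝ) ^ k := by
      intro z hz
      rw [mem_filter] at hz ⊢
      obtain ⟨h1, h2, -, h4⟩ := hlev_spec z
      rw [hz.2] at h1 h2 h4
      exact ⟨hz.1, h1, h2, h4⟩
    calc (((S.filter fun z => lev z = k).card : ℕ) : ℝ)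
        ≤ (((S.filter fun z => X z ≤ (4 : ℝ) ^ k ∧ Y z ≤ (4 : ℝ) ^ k ∧ Z z ≤ (8 : ℝ) ^ k).card : ℕ) : ℝ) := by
          exact_mod_cast card_le_card hsub
      _ ≤ A * (128 : ℝ) ^ k := hcount k
  -- group by level
  have hgroup : ∑ z ∈ S, (1 / 256 : ℝ) ^ (lev z) =
      ∑ k ∈ S.image lev, ((S.filter fun z => lev z = k).card : ℝ) * (1 / 256 : ℝ) ^ k := by
    rw [Finset.sum_comp (fun k : ℕ => (1 / 256 : ℝ) ^ k) lev]
    simp only [nsmul_eq_mul]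
  have hgeo : ∑ k ∈ S.image lev, (1 / 2 : ℝ) ^ k ≤ 2 := by
    have h := sum_half_pow_le_of_le (S.image lev) 0 (fun k _ => Nat.zero_le k)
    simpa using h
  calc ∑ z ∈ S, w z ^ 2 * (1 + X z ^ 6 + Y z ^ 6 + Z z ^ 4 + Z' z ^ 6)⁻¹
      ≤ ∑ z ∈ S, 65536 * C ^ 2 * (1 / 256 : ℝ) ^ (lev z) := sum_le_sum hcost
    _ = 65536 * C ^ 2 * ∑ k ∈ S.image lev, ((S.filter fun z => lev z = k).card : ℝ) * (1 / 256 : ℝ) ^ k := by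
        rw [← mul_sum, hgroup]
    _ ≤ 65536 * C ^ 2 * ∑ k ∈ S.image lev, (A * (128 : ℝ) ^ k) * (1 / 256 : ℝ) ^ k := by
        refine mul_le_mul_of_nonneg_left (sum_le_sum fun k _ => ?_) (by positivity)
        exact mul_le_mul_of_nonneg_right (hfib k) (by positivity)
    _ = 65536 * C ^ 2 * A * ∑ k ∈ S.image lev, (1 / 2 : ℝ) ^ k := by
        rw [mul_assoc (65536 * C ^ 2) A, mul_sum (s := S.image lev) (a := A)]
        congr 1
        refine sum_congr rfl fun k _ => ?_
        have : (128 : ℝ) ^ k * (1 / 256 : ℝ) ^ k = (1 / 2 : ℝ) ^ k := by rw [← mul_pow]; norm_num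
        rw [mul_assoc, this]
    _ ≤ 65536 * C ^ 2 * A * 2 := mul_le_mul_of_nonneg_left hgeo (by positivity)
    _ = 131072 * A * C ^ 2 := by ring

end Summit.HubbardSuperconductivity.HubbardSuperconductivity.Theorems.TorusFourierL2

end
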